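import Summits.BirchSwinnertonDyer.BirchSwinnertonDyer.Theorems.PrintX10bBeyondCarrierOfMatchedTwins
import HarnessLib

/-!
# Crux `BeyondCarrierDepthX10b` (stmt-BirchSwinnertonDyer-23055) and its parent J₃ `HeegnerDivisibilityX10b`
# (stmt-21340) BY NAME from the PINNED twins of `route-BirchSwinnertonDyer-PrintX10b` rev 20 —
# `HowardContainmentAnyClassNumberX10bPinned` (26621, A₃^pin) and `TwoSidedLinkAnyClassNumberX10bPinned`
# (26622, B₃^pin) — modulo the three cite-only facts `h331` / `hChaL` / `hKo`

HONEST FRAMING (cell `run/shared/lean/pub/bsd-print-x9/`, LEAD seat bsd-line-x10b-p1 g2 on crux 23055, D-0154 KEY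
row 10): THEOREMS ONLY, conditional glue `--supports 23055`; nothing booked, nothing closed. PrintX10b rev 20 (plan g9,
2026-08-28T07:28Z) re-lines the X10b leaf on the pinned twins (`AssemblyPinnedTwinsX10b`, 26625) and schedules
21340/23055/23729/23730 → aside "after the re-glue"; this file is the kernel LINK the asides then cite: the old
cruxes follow from the new pinned items by name. It instantiates lead g0's PIN-agnostic recipe
`beyondCarrierDepthX10b_of_matchedTwins_of_namedFacts` (p609749) at `R := ∃ jbar D F X, F.Dt = Dt ∧ I(ℋ_F)² ⊆
char_Λ(X_tors)` (the pinned containment), A := 26621 weakened to the sharp frame, B := 26622.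
«beyond-print theorem»: NO. BSD is not proved by any of this; no summit statement is proved by this seat.

* `beyondCarrierDepthX10b_of_pinnedTwins_of_namedFacts (h331 hChaL hKo) (hA : A₃^pin) (hB : B₃^pin) :
  BeyondCarrierDepthX10b` — crux 23055 BY NAME.
* `heegnerDivisibilityX10b_of_pinnedTwins_of_namedFacts (h331 hChaL hKo) (hA) (hB) (hJP : JetchevPrintFactsX10b) :
  HeegnerDivisibilityX10b` — J₃ (21340) BY NAME, through the route's glue `HeegnerDivisibilityX10bGlueBy_holds`.

References: [JetchevSkinnerWan2017] Thm. 3.3.1; [Cha2005] Rmk. 25; [Kolyvagin1990] Thm. A; [Castella2018] §5;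
PrintX10b rev 20 items 26621/26622/26625.
-/

-- the REGISTERED stub namespace `Summit.BirchSwinnertonDyer.BirchSwinnertonDyer.Cruxes.…` repeats the summit name
set_option linter.dupNamespace false
set_option autoImplicit false

noncomputable section

open scoped Classical

open WeierstrassCurve NumberField Literature.NumberTheory.EllipticCurves
  Literature.NumberTheory.EllipticCurves.ModularForms Literature.NumberTheory.EllipticCurves.JetchevSkinnerWan2017
  Summit.BirchSwinnertonDyer.BirchSwinnertonDyer.Theses.PrintX10b

namespace Summit.BirchSwinnertonDyer.BirchSwinnertonDyer.Cruxes.BeyondCarrierDepthX10b.HowardFrames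

/-- **Crux 23055 BY NAME from the pinned twins of PrintX10b rev 20** (A₃^pin = item 26621, B₃^pin = item 26622)
modulo `h331` (JSW Thm. 3.3.1), `hChaL` (Cha 2005 Rmk. 25 lower half), `hKo` (Kolyvagin Thm. A): lead g0's
matched-twins recipe at `R :=` the pinned containment. [cite: JetchevSkinnerWan2017, Thm. 3.3.1]
[cite: Cha2005, Rmk. 25] [cite: Kolyvagin1990, Thm. A] [cite: Castella2018, §5 (eq:IMC+BDP)] -/
theorem beyondCarrierDepthX10b_of_pinnedTwins_of_namedFacts
    (h331 : thm331_anticyclotomicControl)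
    (hChaL : Cha2005.rmk25_pow_dvd_card_sha_primary_of_certificate)
    (hKo : ∀ (N : ℕ) [NeZero N] (W : WeierstrassCurve ℚ) (K : Type) [Field K] [NumberField K],
      kolyvagin N W K)
    (hA : HowardContainmentAnyClassNumberX10bPinned) (hB : TwoSidedLinkAnyClassNumberX10bPinned) :
    BeyondCarrierDepthX10b :=
  beyondCarrierDepthX10b_of_matchedTwins_of_namedFacts
    (fun W _ p _ K _ _ κ γ Dt _ _ =>
      ∃ (jbar : AlgebraicClosure K →+* ℂ) (D : (W.baseChange K).LambdaAdicSelmerData κ γ)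
        (F : HeegnerFamily (W.conductorNorm ℤ) W K κ jbar) (X : (W.baseChange K).SelmerDualData κ γ),
        F.Dt = Dt ∧ heegnerCharIdeal D F ^ 2 ≤
          Module.charIdeal (IwasawaAlgebra p) (Submodule.torsion (IwasawaAlgebra p) X.X))
    (fun W _ _ p _ _ K _ _ hX hns hcm hK _ h3 h4 hHN hHp _ _ κ hκ γ _ Dt hc H ιC _ _ _ _ _ =>
      hA W p K hX hns hcm hK h3 h4 hHN hHp κ hκ γ Fact.out Dt H ιC hc)
    (fun W _ _ p _ _ K _ _ hX hns hcm hK hodd h3 _ hHN hHp hirr ι κ hκ γ _ Dt hc H ιC P hP hrk hfin hPinf hR =>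
      hB W p K hX hns hcm hK hodd h3 hHN hHp hirr ι κ hκ γ Dt hc H ιC P hP hrk hfin hPinf hR)
    h331 hChaL hKo

/-- **J₃ `HeegnerDivisibilityX10b` (item 21340) BY NAME from the pinned twins**, the Jetchev print bundle
`JetchevPrintFactsX10b` (item 22890) and `h331` / `hChaL` / `hKo`, through the route's split glue
`HeegnerDivisibilityX10bGlueBy_holds`. [cite: JetchevSkinnerWan2017, Thm. 3.3.1] [cite: Cha2005, Rmk. 25]
[cite: Kolyvagin1990, Thm. A] -/
theorem heegnerDivisibilityX10b_of_pinnedTwins_of_namedFacts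
    (h331 : thm331_anticyclotomicControl)
    (hChaL : Cha2005.rmk25_pow_dvd_card_sha_primary_of_certificate)
    (hKo : ∀ (N : ℕ) [NeZero N] (W : WeierstrassCurve ℚ) (K : Type) [Field K] [NumberField K],
      kolyvagin N W K)
    (hA : HowardContainmentAnyClassNumberX10bPinned) (hB : TwoSidedLinkAnyClassNumberX10bPinned)
    (hJP : JetchevPrintFactsX10b) : HeegnerDivisibilityX10b :=
  HeegnerDivisibilityX10bGlueBy_holds (beyondCarrierDepthX10b_of_pinnedTwins_of_namedFacts h331 hChaL hKo hA hB) hJP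

end Summit.BirchSwinnertonDyer.BirchSwinnertonDyer.Cruxes.BeyondCarrierDepthX10b.HowardFrames

end
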